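import Mathlib.Topology.MetricSpace.HausdorffDimension
import Mathlib.Analysis.SpecialFunctions.Pow.NNReal
import Mathlib.Analysis.SpecialFunctions.Pow.Continuity
import Mathlib.Analysis.SpecificLimits.Basic
import Mathlib.Logic.Equiv.List
import HarnessLib

/-!
# Countable tests for `μH[d] K = 0` and `dim_H K ≤ e` (compact `K`) through a dense family of points

Topic: measure theory / Hausdorff measure and dimension. For a **compact** subset `K` of a
separable metric space `X` and a family of points `v : ι → X` of `K` which is dense in `K`
(typically: the values of a continuous curve at rational times), the statements `μH[d] K = 0`
(`d > 0`) and `dim_H K ≤ e` are equivalent to **countable Boolean combinations of conditions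
`dist (v i) cₖ + 1/(m+1) ≤ r`** on the single points `v i`, with centres `cₖ` running through a
fixed dense sequence of `X` and rational radii `r`
(`hausdorffMeasure_eq_zero_iff_mem_nullCoverable`, `dimH_le_iff_mem_dimHLeSet`). Consequently
the sets `nullCoverable d`, `dimHLeSet e ⊆ (ι → X)` of such families are **measurable** for the
product σ-algebra (`measurableSet_nullCoverable`, `measurableSet_dimHLeSet`), and for a random
continuous curve `γ_ω` whose values `γ_ω(q)` at rational times are measurable in `ω`, the events
`{ω | dim_H γ_ω[0, t] ≤ e}` are measurable (`dimH_image_Icc_le_iff` with the node values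
`nodeVal γ t : ℚ → X`, `q ↦ γ(min q⁺ t)`, and `measurable_nodeVal`). This is the measurability
input of zero-one laws for the Hausdorff dimension of random curves (used for the SLE trace in
`Literature/Probability/RandomPlanarGeometry/CritPercSLEDimensionZeroOne.lean`).

## The argument (all proved, elementary)

* `subset_of_mem_coveredWithMargin` / `exists_mem_coveredWithMargin`: a finite family of open
  balls covers the compact `K ⊇ range v`, `K ⊆ closure (range v)`, iff it covers the points
  `v i` with a uniform margin `1/(m+1)` (compactness: `K` is covered by finitely many of the
  shrunken balls `B(c, r - 1/(m+1))`; conversely every point of `K` is `1/(m+1)`-close to some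
  `v i`).
* `hausdorffMeasure_eq_zero_of_mem_nullCoverable`: covers by balls of radii `rₚ` with
  `∑ rₚ^d ≤ 1/(k+1)` (so `max rₚ → 0`) force `μH[d] K = 0` (Mathlib
  `hausdorffMeasure_le_liminf_sum`).
* `mem_nullCoverable_of_hausdorffMeasure_eq_zero`: if `μH[d] K = 0`, the definition of `μH`
  (Mathlib `hausdorffMeasure_apply`) gives countable covers by sets `tₙ` with
  `∑ diam(tₙ)^d < η`; enlarge `tₙ` to the open ball of radius `diam tₙ + θₙ`, `∑ θₙ^d ≤ η`,
  around one of its points, pass to a finite subcover, and enlarge each ball to a rational ball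
  of at most twice the radius; the `d`-weight is then `≤ 4^d · 2η`.
* `dimH_le_iff_forall_rat`: `dim_H K ≤ e ↔ μH[d] K = 0` for all rational `d > e` (Mathlib
  `hausdorffMeasure_of_dimH_lt`, `dimH_le`, `hausdorffMeasure_mono`,
  `ENNReal.lt_iff_exists_rat_btwn`).

## Mathlib

We USE `MeasureTheory.Measure.hausdorffMeasure_apply`, `hausdorffMeasure_le_liminf_sum`,
`hausdorffMeasure_of_dimH_lt`, `dimH_le`, `hausdorffMeasure_mono`, `IsCompact.elim_finite_subcover`,
`TopologicalSpace.denseSeq`, `Finset.sum_image_le_of_nonneg`, `tsum_geometric_two'`,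
`Continuous.range_subset_closure_image_dense`, `Rat.denseRange_cast`. Mathlib has the Hausdorff
measure and dimension but no measurability statement for `ω ↦ dim_H K(ω)` of a random compact set
(searched `dimH`, `hausdorffMeasure`, `measurableSet_setOf_dimH`).

## References

* P. Mattila, *Geometry of Sets and Measures in Euclidean Spaces*, CUP (1995), §4.1–4.3
  (Hausdorff measures through countable covers; `δ`-covers by open/closed sets and balls).
* K. Falconer, *Fractal Geometry*, 3rd ed., Wiley (2014), §3.2 (equivalent definitions of
  Hausdorff measure and dimension with balls).
-/

noncomputable section

open Set Filter Metric Function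
open _root_.MeasureTheory _root_.MeasureTheory.Measure
open scoped ENNReal NNReal Topology

namespace Literature.MeasureTheory.Hausdorff

/-! ### Curves: node values on `[0, t]` -/

section Nodes

variable {Y : Type*}

/-- The **node values** of a curve `γ : ℝ≥0 → Y` on `[0, t]`: `q ↦ γ (min q⁺ t)`, `q ∈ ℚ` — a
countable family of points of `γ[0, t]`, dense in it when `γ` is continuous
(`image_Icc_subset_closure_range_nodeVal`). [folklore] -/
def nodeVal (γ : ℝ≥0 → Y) (t : ℝ≥0) (q : ℚ) : Y :=
  γ (min (q : ℝ).toNNReal t)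

/-- Every node value lies on `γ[0, t]`. [folklore] -/
theorem range_nodeVal_subset (γ : ℝ≥0 → Y) (t : ℝ≥0) : range (nodeVal γ t) ⊆ γ '' Icc 0 t := by
  rintro _ ⟨q, rfl⟩
  exact ⟨min (q : ℝ).toNNReal t, ⟨zero_le, min_le_right _ _⟩, rfl⟩

/-- The node values depend measurably on the curve (product σ-algebras). [folklore] -/
theorem measurable_nodeVal [MeasurableSpace Y] (t : ℝ≥0) :
    Measurable fun γ : ℝ≥0 → Y ↦ nodeVal γ t :=
  measurable_pi_lambda _ fun _ ↦ measurable_pi_apply _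

/-- For a continuous curve the node values are dense in `γ[0, t]` (`ℚ` is dense in `ℝ` and
`x ↦ γ (min x⁺ t)` is continuous with value `γ s` at `s ∈ [0, t]`). [folklore] -/
theorem image_Icc_subset_closure_range_nodeVal [TopologicalSpace Y] {γ : ℝ≥0 → Y}
    (hγ : Continuous γ) (t : ℝ≥0) : γ '' Icc 0 t ⊆ closure (range (nodeVal γ t)) := by
  rintro _ ⟨s, hs, rfl⟩
  set f : ℝ → Y := fun x ↦ γ (min x.toNNReal t) with hf
  have hfc : Continuous f := hγ.comp (continuous_real_toNNReal.min continuous_const)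
  have hfs : γ s = f (s : ℝ) := by
    simp only [hf, Real.toNNReal_coe, min_eq_left hs.2]
  have hrange : range (nodeVal γ t) = f '' range (fun q : ℚ ↦ (q : ℝ)) := by
    rw [← range_comp]
    rfl
  rw [hfs, hrange]
  exact hfc.range_subset_closure_image_dense Rat.denseRange_cast (mem_range_self _)

end Nodes

variable {X : Type*} [MetricSpace X] [TopologicalSpace.SeparableSpace X] [Nonempty X]

/-- The **rational ball** with code `p = (k, r)`: the open ball of radius `r ∈ ℚ` centred at the
`k`-th point of the fixed dense sequence `TopologicalSpace.denseSeq X` of the separable space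
`X`. [folklore] -/
def ratBall (p : ℕ × ℚ) : Set X :=
  ball (TopologicalSpace.denseSeq X p.1) ((p.2 : ℚ) : ℝ)

/-- Unfolding of `ratBall`. [folklore] -/
theorem mem_ratBall {p : ℕ × ℚ} {x : X} :
    x ∈ (ratBall p : Set X) ↔ dist x (TopologicalSpace.denseSeq X p.1) < ((p.2 : ℚ) : ℝ) := by
  rw [ratBall, mem_ball]

variable {ι : Type*}

/-- `coveredWithMargin F m`: the point families `v : ι → X` every member of which lies in some
ball of the finite family `F` of rational balls with room `1/(m+1)` to spare
(`dist (v i) centre + 1/(m+1) ≤ radius`). [folklore] -/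
def coveredWithMargin (F : Finset (ℕ × ℚ)) (m : ℕ) : Set (ι → X) :=
  {v | ∀ i, ∃ p ∈ F, dist (v i) (TopologicalSpace.denseSeq X p.1) + 1 / ((m : ℝ) + 1) ≤ ((p.2 : ℚ) : ℝ)}

/-- `nullCoverable d`: the point families `v : ι → X` which, for every `k`, are covered with some
margin by a finite family of rational balls of positive radii `rₚ` with `∑ rₚ ^ d ≤ 1/(k+1)`.
For `v` dense in a compact set `K` this is exactly `μH[d] K = 0`
(`hausdorffMeasure_eq_zero_iff_mem_nullCoverable`). [folklore] -/
def nullCoverable (d : ℝ) : Set (ι → X) :=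
  {v | ∀ k : ℕ, ∃ F : Finset (ℕ × ℚ), (∀ p ∈ F, (0 : ℚ) < p.2) ∧
    ∑ p ∈ F, ((p.2 : ℚ) : ℝ) ^ d ≤ 1 / ((k : ℝ) + 1) ∧ ∃ m : ℕ, v ∈ (coveredWithMargin F m : Set (ι → X))}

/-- `dimHLeSet e`: the point families which are `nullCoverable d` for every rational `d` with
`e < d`. For `v` dense in a compact set `K` this is exactly `dim_H K ≤ e`
(`dimH_le_iff_mem_dimHLeSet`). [folklore] -/
def dimHLeSet (e : ℝ≥0∞) : Set (ι → X) :=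
  {v | ∀ d : ℚ, e < ENNReal.ofReal d → v ∈ (nullCoverable (d : ℝ) : Set (ι → X))}

/-! ### Covers with margin -/

/-- If the points `v i` are covered with margin `1/(m+1)` by the balls of `F`, then every set in
the closure of `{v i}` is covered by the balls of `F`. [folklore] -/
theorem subset_of_mem_coveredWithMargin {v : ι → X} {K : Set X} (hK : K ⊆ closure (range v))
    {F : Finset (ℕ × ℚ)} {m : ℕ} (h : v ∈ (coveredWithMargin F m : Set (ι → X))) :
    K ⊆ ⋃ p ∈ F, (ratBall p : Set X) := by
  intro x hx
  have hx' := hK hx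
  rw [Metric.mem_closure_iff] at hx'
  obtain ⟨y, ⟨i, rfl⟩, hyi⟩ := hx' (1 / ((m : ℝ) + 1)) (by positivity)
  obtain ⟨p, hpF, hp⟩ := h i
  refine mem_iUnion₂.2 ⟨p, hpF, ?_⟩
  rw [mem_ratBall]
  calc dist x (TopologicalSpace.denseSeq X p.1)
      ≤ dist x (v i) + dist (v i) (TopologicalSpace.denseSeq X p.1) := dist_triangle _ _ _
    _ < 1 / ((m : ℝ) + 1) + dist (v i) (TopologicalSpace.denseSeq X p.1) := by gcongr
    _ ≤ ((p.2 : ℚ) : ℝ) := by linarith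

/-- Conversely, if a compact set `K` containing all the points `v i` is covered by the (open)
balls of the finite family `F`, then the `v i` are covered with a uniform margin: `K` is covered
by the shrunken balls `B(cₚ, rₚ - 1/(m+1))`, `p ∈ F`, `m ∈ ℕ`, hence by finitely many of them.
[folklore] -/
theorem exists_mem_coveredWithMargin {v : ι → X} {K : Set X} (hKc : IsCompact K)
    (hv : range v ⊆ K) {F : Finset (ℕ × ℚ)} (hF : K ⊆ ⋃ p ∈ F, (ratBall p : Set X)) :
    ∃ m : ℕ, v ∈ (coveredWithMargin F m : Set (ι → X)) := by
  classical
  set b : (ℕ × ℚ) × ℕ → Set X := fun pm ↦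
    if pm.1 ∈ F then ball (TopologicalSpace.denseSeq X pm.1.1) (((pm.1.2 : ℚ) : ℝ) - 1 / ((pm.2 : ℝ) + 1))
    else ∅ with hb_def
  have hb : ∀ pm, IsOpen (b pm) := fun pm ↦ by
    simp only [hb_def]
    split_ifs
    exacts [isOpen_ball, isOpen_empty]
  have hKb : K ⊆ ⋃ pm, b pm := by
    intro x hx
    obtain ⟨p, hpF, hxp⟩ := mem_iUnion₂.1 (hF hx)
    rw [mem_ratBall] at hxp
    obtain ⟨m, hm⟩ := exists_nat_one_div_lt (sub_pos.2 hxp)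
    refine mem_iUnion.2 ⟨(p, m), ?_⟩
    simp only [hb_def, if_pos hpF, mem_ball]
    linarith
  obtain ⟨T, hT⟩ := hKc.elim_finite_subcover b hb hKb
  refine ⟨T.sup fun pm ↦ pm.2, fun i ↦ ?_⟩
  obtain ⟨pm, hpmT, hi⟩ := mem_iUnion₂.1 (hT (hv (mem_range_self i)))
  have hpF : pm.1 ∈ F := by
    by_contra h
    simp [hb_def, h] at hi
  refine ⟨pm.1, hpF, ?_⟩
  simp only [hb_def, if_pos hpF, mem_ball] at hi
  have hle : (pm.2 : ℝ) ≤ ((T.sup fun pm ↦ pm.2 : ℕ) : ℝ) := by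
    exact_mod_cast Finset.le_sup (f := fun pm : (ℕ × ℚ) × ℕ ↦ pm.2) hpmT
  have h1 : 1 / (((T.sup fun pm ↦ pm.2 : ℕ) : ℝ) + 1) ≤ 1 / ((pm.2 : ℝ) + 1) :=
    one_div_le_one_div_of_le (by positivity) (by linarith)
  linarith [hi.le]

/-! ### `μH[d] K = 0` -/

section Null

variable [MeasurableSpace X] [BorelSpace X]

/-- An elementary inequality: `(a + b) ^ d ≤ 2 ^ d (a ^ d + b ^ d)` (`a, b, d ≥ 0`). [folklore] -/
theorem add_rpow_le_two_rpow_mul {a b d : ℝ} (ha : 0 ≤ a) (hb : 0 ≤ b) (hd : 0 ≤ d) :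
    (a + b) ^ d ≤ 2 ^ d * (a ^ d + b ^ d) := by
  have had : 0 ≤ a ^ d := Real.rpow_nonneg ha d
  have hbd : 0 ≤ b ^ d := Real.rpow_nonneg hb d
  rcases le_total a b with hab | hab
  · calc (a + b) ^ d ≤ (2 * b) ^ d := Real.rpow_le_rpow (by positivity) (by linarith) hd
      _ = 2 ^ d * b ^ d := Real.mul_rpow (by norm_num) hb
      _ ≤ 2 ^ d * (a ^ d + b ^ d) := by gcongr; linarith
  · calc (a + b) ^ d ≤ (2 * a) ^ d := Real.rpow_le_rpow (by positivity) (by linarith) hd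
      _ = 2 ^ d * a ^ d := Real.mul_rpow (by norm_num) ha
      _ ≤ 2 ^ d * (a ^ d + b ^ d) := by gcongr; linarith

/-- **Null sets of `μH[d]` from small covers.** If the points `v i` are dense in `K` and
`v ∈ nullCoverable d` (`d > 0`), then `μH[d] K = 0`: `K` is covered by finitely many balls of
radii `rₚ` with `∑ (2rₚ)^d ≤ 2^d/(k+1)` and `max rₚ → 0` (Mathlib `hausdorffMeasure_le_liminf_sum`).
[folklore] -/
theorem hausdorffMeasure_eq_zero_of_mem_nullCoverable {v : ι → X} {K : Set X} {d : ℝ} (hd : 0 < d)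
    (hK : K ⊆ closure (range v)) (h : v ∈ (nullCoverable d : Set (ι → X))) :
    μH[d] K = 0 := by
  have h' : ∀ k : ℕ, ∃ F : Finset (ℕ × ℚ), (∀ p ∈ F, (0 : ℚ) < p.2) ∧
      ∑ p ∈ F, ((p.2 : ℚ) : ℝ) ^ d ≤ 1 / ((k : ℝ) + 1) ∧ ∃ m : ℕ, v ∈ (coveredWithMargin F m : Set (ι → X)) := h
  choose F hFpos hFsum hFm using h'
  have hcover : ∀ k, K ⊆ ⋃ p ∈ F k, (ratBall p : Set X) := fun k ↦ by
    obtain ⟨m, hm⟩ := hFm k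
    exact subset_of_mem_coveredWithMargin hK hm
  have hnn : ∀ k, ∀ p ∈ F k, (0 : ℝ) ≤ ((p.2 : ℚ) : ℝ) := fun k p hp ↦ by
    exact_mod_cast (hFpos k p hp).le
  -- the radii are uniformly small
  set δ : ℕ → ℝ := fun k ↦ (1 / ((k : ℝ) + 1)) ^ (1 / d) with hδ
  have hδ0 : ∀ k, 0 ≤ δ k := fun k ↦ Real.rpow_nonneg (by positivity) _
  have hrad : ∀ k, ∀ p ∈ F k, ((p.2 : ℚ) : ℝ) ≤ δ k := by
    intro k p hp
    have h1 : ((p.2 : ℚ) : ℝ) ^ d ≤ 1 / ((k : ℝ) + 1) :=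
      (Finset.single_le_sum (fun q hq ↦ Real.rpow_nonneg (hnn k q hq) d) hp).trans (hFsum k)
    calc ((p.2 : ℚ) : ℝ) = ((((p.2 : ℚ) : ℝ)) ^ d) ^ (1 / d) := by
          rw [← Real.rpow_mul (hnn k p hp), mul_one_div_cancel hd.ne', Real.rpow_one]
      _ ≤ δ k := Real.rpow_le_rpow (Real.rpow_nonneg (hnn k p hp) d) h1 (by positivity)
  have hδt : Tendsto δ atTop (𝓝 0) := by
    have h1 : Tendsto (fun k : ℕ ↦ 1 / ((k : ℝ) + 1)) atTop (𝓝 0) :=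
      tendsto_one_div_add_atTop_nhds_zero_nat
    have h2 : Tendsto (fun x : ℝ ↦ x ^ (1 / d)) (𝓝 0) (𝓝 ((0 : ℝ) ^ (1 / d))) :=
      (Real.continuous_rpow_const (by positivity)).tendsto 0
    rw [Real.zero_rpow (by positivity)] at h2
    exact h2.comp h1
  -- Mathlib's covering bound
  have key := hausdorffMeasure_le_liminf_sum (ι := fun k ↦ ↥(F k)) d K (l := atTop)
    (fun k : ℕ ↦ ENNReal.ofReal (2 * δ k)) ?_ (fun k (p : ↥(F k)) ↦ (ratBall p.1 : Set X)) ?_ ?_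
  rotate_left
  · have h := (ENNReal.tendsto_ofReal (hδt.const_mul 2))
    simpa using h
  · refine Eventually.of_forall fun k p ↦ ?_
    refine Metric.ediam_le_of_forall_dist_le fun x hx y hy ↦ ?_
    rw [mem_ratBall] at hx hy
    calc dist x y ≤ dist x (TopologicalSpace.denseSeq X p.1.1) + dist y (TopologicalSpace.denseSeq X p.1.1) :=
          dist_triangle_right _ _ _
      _ ≤ 2 * δ k := by linarith [hrad k p.1 p.2]
  · refine Eventually.of_forall fun k x hx ↦ ?_
    obtain ⟨p, hp, hxp⟩ := mem_iUnion₂.1 (hcover k hx)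
    exact mem_iUnion.2 ⟨⟨p, hp⟩, hxp⟩
  -- the sums tend to zero
  have hsum_le : ∀ k, ∑ p : ↥(F k), ediam (ratBall p.1 : Set X) ^ d ≤
      ENNReal.ofReal (2 ^ d * (1 / ((k : ℝ) + 1))) := by
    intro k
    have h1 : ∀ p ∈ F k, ediam (ratBall p : Set X) ^ d ≤ ENNReal.ofReal ((2 * ((p.2 : ℚ) : ℝ)) ^ d) := by
      intro p hp
      have he : ediam (ratBall p : Set X) ≤ ENNReal.ofReal (2 * ((p.2 : ℚ) : ℝ)) := by
        refine Metric.ediam_le_of_forall_dist_le fun x hx y hy ↦ ?_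
        rw [mem_ratBall] at hx hy
        calc dist x y ≤ dist x (TopologicalSpace.denseSeq X p.1) + dist y (TopologicalSpace.denseSeq X p.1) :=
              dist_triangle_right _ _ _
          _ ≤ 2 * ((p.2 : ℚ) : ℝ) := by linarith
      calc ediam (ratBall p : Set X) ^ d ≤ (ENNReal.ofReal (2 * ((p.2 : ℚ) : ℝ))) ^ d :=
            ENNReal.rpow_le_rpow he hd.le
        _ = ENNReal.ofReal ((2 * ((p.2 : ℚ) : ℝ)) ^ d) :=
            ENNReal.ofReal_rpow_of_nonneg (by linarith [hnn k p hp]) hd.le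
    calc ∑ p : ↥(F k), ediam (ratBall p.1 : Set X) ^ d
        = ∑ p ∈ F k, ediam (ratBall p : Set X) ^ d :=
          Finset.sum_coe_sort (F k) (fun p ↦ ediam (ratBall p : Set X) ^ d)
      _ ≤ ∑ p ∈ F k, ENNReal.ofReal ((2 * ((p.2 : ℚ) : ℝ)) ^ d) := Finset.sum_le_sum h1
      _ = ENNReal.ofReal (∑ p ∈ F k, (2 * ((p.2 : ℚ) : ℝ)) ^ d) :=
          (ENNReal.ofReal_sum_of_nonneg fun p hp ↦ Real.rpow_nonneg (by linarith [hnn k p hp]) d).symm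
      _ = ENNReal.ofReal (2 ^ d * ∑ p ∈ F k, ((p.2 : ℚ) : ℝ) ^ d) := by
          congr 1
          rw [Finset.mul_sum]
          exact Finset.sum_congr rfl fun p hp ↦ Real.mul_rpow (by norm_num) (hnn k p hp)
      _ ≤ ENNReal.ofReal (2 ^ d * (1 / ((k : ℝ) + 1))) := by
          gcongr
          exact hFsum k
  have hlim : Tendsto (fun k : ℕ ↦ ENNReal.ofReal (2 ^ d * (1 / ((k : ℝ) + 1)))) atTop (𝓝 0) := by
    have h := ENNReal.tendsto_ofReal (tendsto_one_div_add_atTop_nhds_zero_nat.const_mul (2 ^ d))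
    simpa using h
  have hliminf : liminf (fun k ↦ ∑ p : ↥(F k), ediam (ratBall p.1 : Set X) ^ d) atTop ≤ 0 := by
    calc liminf (fun k ↦ ∑ p : ↥(F k), ediam (ratBall p.1 : Set X) ^ d) atTop
        ≤ liminf (fun k : ℕ ↦ ENNReal.ofReal (2 ^ d * (1 / ((k : ℝ) + 1)))) atTop :=
          liminf_le_liminf (Eventually.of_forall hsum_le)
      _ = 0 := hlim.liminf_eq
  exact le_antisymm (key.trans hliminf) zero_le

/-- **Small covers of `μH[d]`-null compact sets.** Conversely, if `K` is compact with
`μH[d] K = 0` (`d > 0`) and all `v i ∈ K`, then `v ∈ nullCoverable d`: a countable cover of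
small `d`-weight (definition of `μH`) is enlarged to open balls, reduced to a finite subcover,
and its balls are enlarged to rational ones of at most twice the radius. [folklore] -/
theorem mem_nullCoverable_of_hausdorffMeasure_eq_zero {v : ι → X} {K : Set X} {d : ℝ}
    (hd : 0 < d) (hKc : IsCompact K) (hv : range v ⊆ K) (h0 : μH[d] K = 0) :
    v ∈ (nullCoverable d : Set (ι → X)) := by
  classical
  intro k
  set ε : ℝ := 1 / ((k : ℝ) + 1) with hε
  have hε0 : 0 < ε := by positivity
  rcases K.eq_empty_or_nonempty with hKe | hKne
  · refine ⟨∅, by simp, by simp [hε0.le], 0, fun i ↦ ?_⟩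
    exact absurd (hv (mem_range_self i)) (by simp [hKe])
  obtain ⟨x₀, -⟩ := hKne
  have h4 : (0 : ℝ) < 4 ^ d := Real.rpow_pos_of_pos (by norm_num) d
  set η : ℝ := ε / (2 * 4 ^ d) with hη
  have hη0 : 0 < η := by positivity
  -- Step 1: a countable cover of small `d`-weight
  obtain ⟨t, htK, htd, hsum⟩ : ∃ t : ℕ → Set X, K ⊆ ⋃ n, t n ∧ (∀ n, ediam (t n) ≤ 1) ∧
      ∑' n, ⨆ _ : (t n).Nonempty, ediam (t n) ^ d < ENNReal.ofReal η := by
    have hle : (⨅ (t : ℕ → Set X) (_ : K ⊆ ⋃ n, t n) (_ : ∀ n, ediam (t n) ≤ (1 : ℝ≥0∞)),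
        ∑' n, ⨆ _ : (t n).Nonempty, ediam (t n) ^ d) ≤ μH[d] K := by
      rw [hausdorffMeasure_apply]
      exact le_iSup₂ (f := fun (r : ℝ≥0∞) (_ : 0 < r) ↦ ⨅ (t : ℕ → Set X) (_ : K ⊆ ⋃ n, t n)
        (_ : ∀ n, ediam (t n) ≤ r), ∑' n, ⨆ _ : (t n).Nonempty, ediam (t n) ^ d) 1 one_pos
    rw [h0] at hle
    have hlt : (⨅ (t : ℕ → Set X) (_ : K ⊆ ⋃ n, t n) (_ : ∀ n, ediam (t n) ≤ (1 : ℝ≥0∞)),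
        ∑' n, ⨆ _ : (t n).Nonempty, ediam (t n) ^ d) < ENNReal.ofReal η :=
      lt_of_le_of_lt hle (by simpa using hη0)
    simp only [iInf_lt_iff] at hlt
    obtain ⟨t, htK, htd, hsum⟩ := hlt
    exact ⟨t, htK, htd, hsum⟩
  -- Step 2: balls around the pieces of the cover, and a finite subcover
  have hfin : ∀ n, ediam (t n) ≠ ⊤ := fun n ↦ ne_top_of_le_ne_top ENNReal.one_ne_top (htd n)
  set xc : ℕ → X := fun n ↦ if h : (t n).Nonempty then h.some else x₀ with hxc
  set ρ : ℕ → ℝ := fun n ↦ (ediam (t n)).toReal with hρ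
  have hρ0 : ∀ n, 0 ≤ ρ n := fun n ↦ ENNReal.toReal_nonneg
  set θ : ℕ → ℝ := fun n ↦ (η / 2 / 2 ^ n) ^ (1 / d) with hθ
  have hθ0 : ∀ n, 0 < θ n := fun n ↦ Real.rpow_pos_of_pos (by positivity) _
  have hθd : ∀ n, θ n ^ d = η / 2 / 2 ^ n := fun n ↦ by
    rw [hθ, ← Real.rpow_mul (by positivity), one_div_mul_cancel hd.ne', Real.rpow_one]
  set R : ℕ → ℝ := fun n ↦ ρ n + θ n with hR
  have hR0 : ∀ n, 0 < R n := fun n ↦ add_pos_of_nonneg_of_pos (hρ0 n) (hθ0 n)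
  have htball : ∀ n, t n ⊆ ball (xc n) (R n) := by
    intro n y hy
    have hne : (t n).Nonempty := ⟨y, hy⟩
    have hx : xc n ∈ t n := by
      simp only [hxc, dif_pos hne]
      exact hne.some_mem
    rw [mem_ball]
    have h1 : edist y (xc n) ≤ ediam (t n) := edist_le_ediam_of_mem hy hx
    have h2 : dist y (xc n) ≤ ρ n := by
      rw [dist_edist]
      exact ENNReal.toReal_mono (hfin n) h1
    linarith [hθ0 n]
  obtain ⟨T, hT⟩ := hKc.elim_finite_subcover (fun n ↦ ball (xc n) (R n)) (fun n ↦ isOpen_ball)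
    (htK.trans (iUnion_mono htball))
  -- Step 3: rational balls of at most twice the radius
  have hrat : ∀ n, ∃ p : ℕ × ℚ, ball (xc n) (R n) ⊆ (ratBall p : Set X) ∧ R n ≤ ((p.2 : ℚ) : ℝ) ∧
      ((p.2 : ℚ) : ℝ) ≤ 2 * R n := by
    intro n
    obtain ⟨c, hc⟩ : ∃ c : ℕ, dist (xc n) (TopologicalSpace.denseSeq X c) < R n / 2 :=
      Metric.denseRange_iff.1 (TopologicalSpace.denseRange_denseSeq X) (xc n) (R n / 2)
        (half_pos (hR0 n))
    have hRn := hR0 n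
    obtain ⟨q, hq1, hq2⟩ := exists_rat_btwn
      (show dist (xc n) (TopologicalSpace.denseSeq X c) + R n < 2 * R n by linarith)
    refine ⟨(c, q), ?_, ?_, hq2.le⟩
    · refine ball_subset_ball' ?_
      linarith
    · linarith [dist_nonneg (x := xc n) (y := TopologicalSpace.denseSeq X c)]
  choose g hg₁ hg₂ hg₃ using hrat
  have hgpos : ∀ n, (0 : ℝ) < (((g n).2 : ℚ) : ℝ) := fun n ↦ (hR0 n).trans_le (hg₂ n)
  -- the `d`-weights
  have hterm : ∀ n, ENNReal.ofReal (ρ n ^ d) ≤ ⨆ _ : (t n).Nonempty, ediam (t n) ^ d := by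
    intro n
    rcases (t n).eq_empty_or_nonempty with he | hne
    · simp [hρ, he, Real.zero_rpow hd.ne']
    · rw [iSup_pos hne]
      calc ENNReal.ofReal (ρ n ^ d) = ENNReal.ofReal ((ediam (t n) ^ d).toReal) := by
            rw [hρ, ENNReal.toReal_rpow]
        _ ≤ ediam (t n) ^ d := ENNReal.ofReal_toReal_le
  have hsumρ : ∑ n ∈ T, ρ n ^ d ≤ η := by
    have h1 : ∑ n ∈ T, ENNReal.ofReal (ρ n ^ d) ≤ ENNReal.ofReal η :=
      calc ∑ n ∈ T, ENNReal.ofReal (ρ n ^ d)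
          ≤ ∑ n ∈ T, ⨆ _ : (t n).Nonempty, ediam (t n) ^ d := Finset.sum_le_sum fun n _ ↦ hterm n
        _ ≤ ∑' n, ⨆ _ : (t n).Nonempty, ediam (t n) ^ d := ENNReal.sum_le_tsum T
        _ ≤ ENNReal.ofReal η := hsum.le
    rw [← ENNReal.ofReal_sum_of_nonneg (fun n _ ↦ Real.rpow_nonneg (hρ0 n) d)] at h1
    exact (ENNReal.ofReal_le_ofReal_iff hη0.le).1 h1
  have hsumθ : ∑ n ∈ T, θ n ^ d ≤ η := by
    simp only [hθd]
    calc ∑ n ∈ T, η / 2 / 2 ^ n ≤ ∑' n, η / 2 / 2 ^ n :=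
          (summable_geometric_two' η).sum_le_tsum T fun n _ ↦ by positivity
      _ = η := tsum_geometric_two' η
  refine ⟨T.image g, ?_, ?_, ?_⟩
  · intro p hp
    obtain ⟨n, -, rfl⟩ := Finset.mem_image.1 hp
    exact_mod_cast hgpos n
  · calc ∑ p ∈ T.image g, ((p.2 : ℚ) : ℝ) ^ d
        ≤ ∑ n ∈ T, (((g n).2 : ℚ) : ℝ) ^ d :=
          Finset.sum_image_le_of_nonneg fun p hp ↦ by
            obtain ⟨n, -, rfl⟩ := Finset.mem_image.1 hp
            exact Real.rpow_nonneg (hgpos n).le d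
      _ ≤ ∑ n ∈ T, (2 * R n) ^ d :=
          Finset.sum_le_sum fun n _ ↦ Real.rpow_le_rpow (hgpos n).le (hg₃ n) hd.le
      _ = 2 ^ d * ∑ n ∈ T, R n ^ d := by
          rw [Finset.mul_sum]
          exact Finset.sum_congr rfl fun n _ ↦ Real.mul_rpow (by norm_num) (hR0 n).le
      _ ≤ 2 ^ d * ∑ n ∈ T, 2 ^ d * (ρ n ^ d + θ n ^ d) := by
          gcongr with n hn
          exact add_rpow_le_two_rpow_mul (hρ0 n) (hθ0 n).le hd.le
      _ = 4 ^ d * (∑ n ∈ T, ρ n ^ d + ∑ n ∈ T, θ n ^ d) := by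
          rw [← Finset.mul_sum, Finset.sum_add_distrib, ← mul_assoc,
            ← Real.mul_rpow two_pos.le two_pos.le]
          norm_num
      _ ≤ 4 ^ d * (η + η) := by gcongr
      _ = ε := by
          rw [hη]
          field_simp
          ring
  · refine exists_mem_coveredWithMargin hKc hv fun y hy ↦ ?_
    obtain ⟨n, hnT, hyn⟩ := mem_iUnion₂.1 (hT hy)
    exact mem_iUnion₂.2 ⟨g n, Finset.mem_image_of_mem g hnT, hg₁ n hyn⟩

/-- **Countable test for `μH[d] K = 0`** (`K` compact, `d > 0`, `v` a family of points of `K`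
dense in `K`): `μH[d] K = 0 ↔ v ∈ nullCoverable d`. [folklore] -/
theorem hausdorffMeasure_eq_zero_iff_mem_nullCoverable {v : ι → X} {K : Set X} {d : ℝ}
    (hd : 0 < d) (hKc : IsCompact K) (hv : range v ⊆ K) (hK : K ⊆ closure (range v)) :
    μH[d] K = 0 ↔ v ∈ (nullCoverable d : Set (ι → X)) :=
  ⟨mem_nullCoverable_of_hausdorffMeasure_eq_zero hd hKc hv,
    hausdorffMeasure_eq_zero_of_mem_nullCoverable hd hK⟩

/-! ### `dim_H K ≤ e` -/

omit [TopologicalSpace.SeparableSpace X] [Nonempty X] in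
/-- `dim_H K ≤ e` iff `μH[d] K = 0` for every rational `d > e` (Mathlib `hausdorffMeasure_of_dimH_lt`,
`dimH_le`, `hausdorffMeasure_mono` and the density of `ℚ` in `ℝ≥0∞`). [folklore] -/
theorem dimH_le_iff_forall_rat {K : Set X} {e : ℝ≥0∞} :
    dimH K ≤ e ↔ ∀ d : ℚ, e < ENNReal.ofReal d → μH[(d : ℝ)] K = 0 := by
  constructor
  · intro h d hd
    have hd0 : (0 : ℝ) ≤ d := by
      by_contra hneg
      push Not at hneg
      rw [ENNReal.ofReal_of_nonpos hneg.le] at hd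
      exact ENNReal.not_lt_zero hd
    have h' : dimH K < ((d : ℝ).toNNReal : ℝ≥0∞) := h.trans_lt hd
    have := hausdorffMeasure_of_dimH_lt h'
    rwa [Real.coe_toNNReal _ hd0] at this
  · intro h
    refine dimH_le fun d' hd' ↦ ?_
    by_contra hlt
    push Not at hlt
    obtain ⟨q, -, hq1, hq2⟩ := ENNReal.lt_iff_exists_rat_btwn.1 hlt
    have hq0 : (0 : ℝ) ≤ q := by
      by_contra hneg
      push Not at hneg
      have : ((q : ℝ).toNNReal : ℝ≥0∞) = 0 := by simp [Real.toNNReal_of_nonpos hneg.le]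
      rw [this] at hq1
      exact ENNReal.not_lt_zero hq1
    have hzero : μH[(q : ℝ)] K = 0 := h q hq1
    have hle : ((q : ℝ).toNNReal : ℝ) ≤ d' := by
      have : ((q : ℝ).toNNReal : ℝ≥0) < d' := by exact_mod_cast hq2
      exact_mod_cast this.le
    rw [Real.coe_toNNReal _ hq0] at hle
    have hmono := hausdorffMeasure_mono hle K
    rw [hd', hzero] at hmono
    exact absurd hmono (by simp)

/-- **Countable test for `dim_H K ≤ e`** (`K` compact, `v` a family of points of `K` dense in `K`):
`dim_H K ≤ e ↔ v ∈ dimHLeSet e`. [folklore] -/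
theorem dimH_le_iff_mem_dimHLeSet {v : ι → X} {K : Set X}
    (hKc : IsCompact K) (hv : range v ⊆ K) (hK : K ⊆ closure (range v)) {e : ℝ≥0∞} :
    dimH K ≤ e ↔ v ∈ (dimHLeSet e : Set (ι → X)) := by
  rw [dimH_le_iff_forall_rat]
  refine forall_congr' fun d ↦ imp_congr_right fun hd ↦ ?_
  have hd0 : (0 : ℝ) < d := by
    by_contra hneg
    push Not at hneg
    rw [ENNReal.ofReal_of_nonpos hneg] at hd
    exact ENNReal.not_lt_zero hd
  exact hausdorffMeasure_eq_zero_iff_mem_nullCoverable hd0 hKc hv hK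

end Null

/-! ### Measurability of the tests -/

section Measurable

variable [MeasurableSpace X] [OpensMeasurableSpace X] [Countable ι]

/-- `coveredWithMargin F m` is a measurable set of the product space `ι → X`. [folklore] -/
theorem measurableSet_coveredWithMargin (F : Finset (ℕ × ℚ)) (m : ℕ) :
    MeasurableSet (coveredWithMargin F m : Set (ι → X)) := by
  have h : (coveredWithMargin F m : Set (ι → X)) =
      ⋂ i, ⋃ p ∈ F, {v : ι → X | dist (v i) (TopologicalSpace.denseSeq X p.1) + 1 / ((m : ℝ) + 1) ≤
        ((p.2 : ℚ) : ℝ)} := by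
    ext v
    simp only [coveredWithMargin, mem_setOf_eq, mem_iInter, mem_iUnion, exists_prop]
  rw [h]
  refine MeasurableSet.iInter fun i ↦ Finset.measurableSet_biUnion F fun p _ ↦ ?_
  refine measurableSet_le ?_ measurable_const
  exact ((continuous_id.dist continuous_const).measurable.comp (measurable_pi_apply i)).add_const _

/-- `nullCoverable d` is a measurable set of the product space `ι → X`. [folklore] -/
theorem measurableSet_nullCoverable (d : ℝ) :
    MeasurableSet (nullCoverable d : Set (ι → X)) := by
  have h : (nullCoverable d : Set (ι → X)) =
      ⋂ k : ℕ, ⋃ F ∈ {F : Finset (ℕ × ℚ) | (∀ p ∈ F, (0 : ℚ) < p.2) ∧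
        ∑ p ∈ F, ((p.2 : ℚ) : ℝ) ^ d ≤ 1 / ((k : ℝ) + 1)}, ⋃ m : ℕ,
          (coveredWithMargin F m : Set (ι → X)) := by
    ext v
    simp only [nullCoverable, mem_setOf_eq, mem_iInter, mem_iUnion, exists_prop, and_assoc]
  rw [h]
  refine MeasurableSet.iInter fun k ↦ MeasurableSet.biUnion (Set.to_countable _) fun F _ ↦ ?_
  exact MeasurableSet.iUnion fun m ↦ measurableSet_coveredWithMargin F m

/-- `dimHLeSet e` is a measurable set of the product space `ι → X`. [folklore] -/
theorem measurableSet_dimHLeSet (e : ℝ≥0∞) :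
    MeasurableSet (dimHLeSet e : Set (ι → X)) := by
  have h : (dimHLeSet e : Set (ι → X)) =
      ⋂ d ∈ {d : ℚ | e < ENNReal.ofReal d}, (nullCoverable (d : ℝ) : Set (ι → X)) := by
    ext v
    simp only [dimHLeSet, mem_setOf_eq, mem_iInter]
  rw [h]
  exact MeasurableSet.biInter (Set.to_countable _) fun d _ ↦ measurableSet_nullCoverable (d : ℝ)

end Measurable

/-! ### Curves: `dim_H γ[0, t] ≤ e` through the node values -/

section Curve

variable [MeasurableSpace X] [BorelSpace X]

/-- **Countable test for `dim_H γ[0, t] ≤ e`** (`γ` continuous): `dim_H γ[0, t] ≤ e` iff the node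
values `q ↦ γ(min q⁺ t)` belong to the measurable set `dimHLeSet e`. [folklore] -/
theorem dimH_image_Icc_le_iff {γ : ℝ≥0 → X} (hγ : Continuous γ) (t : ℝ≥0) (e : ℝ≥0∞) :
    dimH (γ '' Icc 0 t) ≤ e ↔ nodeVal γ t ∈ (dimHLeSet e : Set (ℚ → X)) :=
  dimH_le_iff_mem_dimHLeSet (isCompact_Icc.image hγ) (range_nodeVal_subset γ t)
    (image_Icc_subset_closure_range_nodeVal hγ t)

end Curve

end Literature.MeasureTheory.Hausdorff

end
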